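import Mathlib
import Literature.NumberTheory.Transcendental.BlochWignerDilogarithm
import HarnessLib

/-!
# `ZagierDilogarithmConjecture` (stmt-KontsevichZagierPeriods-10550) — line
`kummer-clausen-linearisation` (reshape c4, "the cyclotomic sector, exactly"), stub
`stub_clausenCharSum_ne_zero`

**Non-vanishing of the Clausen character sum of every odd character.** Let `ζ_N = exp(2πi/N)`
(`N ≥ 1`), `D` the Bloch–Wigner dilogarithm (`blochWignerDilog`) and, for a Dirichlet character
`χ mod N`, `Λ_N(χ) := Σ_{c mod N} χ(c) · D(ζ_N^c)` its Clausen character sum. Assume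
* (H1) `Λ_N(χ) ≠ 0` for every PRIMITIVE odd `χ mod N` (neighbour `stub_clausenCharSumPrimitive`:
  `Λ = −i · W(χ) · L(2, χ⁻¹)`), and
* (H2) the level-raising identity `Λ_{Mp}(χ↑) = (1/p − χ(p)) · Λ_M(χ)` for `χ mod M`, `p` prime and
  `χ↑ = changeLevel χ mod Mp` (neighbour `stub_clausenCharSumLevel`).
Then `Λ_N(χ) ≠ 0` for EVERY odd `χ mod N`.

Proof: strong induction on `N`. A primitive `χ` is (H1). Otherwise the conductor `f` of `χ` is a
proper divisor of `N`; pick a prime `p ∣ N/f` and put `M := N/p`, so `f ∣ M ∣ N = M·p` and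
`χ = χ'↑` for a character `χ' mod M` (`FactorsThrough.mono`), which is again odd
(`(χ'↑)(−1) = χ'(−1)`). By (H2), `Λ_N(χ) = (1/p − χ'(p)) · Λ_M(χ')`; the second factor is non-zero
by induction (`M < N`) and the first because `|χ'(p)| ∈ {0, 1}` while `0 < 1/p < 1`.
Mathlib only; sorry-free; axioms ⊆ {propext, Classical.choice, Quot.sound}.

## References

* T. M. Apostol, *Introduction to Analytic Number Theory*, UTM, Springer (1976), §8.9 (induced
  moduli and primitive characters). [Apostol1976]
-/

noncomputable section

open scoped BigOperators
open Literature.NumberTheory.Transcendental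

namespace Summit.KontsevichZagierPeriods.HyperbolicBloch.ZagierDilogarithmCyclotomic

namespace ClausenInduction

/-! ### Three elementary facts about Dirichlet characters -/

/-- Level change preserves oddness: `(χ'↑)(−1) = χ'(−1)`, so `χ'↑` odd implies `χ'` odd.
[folklore] -/
theorem odd_of_odd_changeLevel {M N : ℕ} (hMN : M ∣ N) (χ' : DirichletCharacter ℂ M)
    (h : (DirichletCharacter.changeLevel hMN χ').Odd) : χ'.Odd := by
  have key := DirichletCharacter.changeLevel_eq_cast_of_dvd χ' hMN (-1)
  rw [Units.val_neg, Units.val_one, ZMod.cast_neg hMN, ZMod.cast_one hMN] at key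
  rw [DirichletCharacter.Odd] at h ⊢
  rw [← key]
  exact h

/-- For a prime `p` and any Dirichlet character `χ`: `1/p − χ(p) ≠ 0`, since `χ(p)` is `0` or of
norm `1` while `‖1/p‖ = 1/p ∈ (0, 1)`. [folklore] -/
theorem inv_sub_char_ne_zero {M p : ℕ} (hp : p.Prime) (χ : DirichletCharacter ℂ M) :
    (p : ℂ)⁻¹ - χ (p : ZMod M) ≠ 0 := by
  intro h
  rw [sub_eq_zero] at h
  have hp0 : (p : ℂ) ≠ 0 := by exact_mod_cast hp.ne_zero
  have hnorm : ‖(p : ℂ)⁻¹‖ < 1 := by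
    rw [norm_inv, Complex.norm_natCast]
    exact inv_lt_one_of_one_lt₀ (by exact_mod_cast hp.one_lt)
  by_cases hu : IsUnit (p : ZMod M)
  · have h1 := χ.unit_norm_eq_one hu.unit
    rw [IsUnit.unit_spec, ← h] at h1
    exact hnorm.ne h1
  · rw [MulChar.map_nonunit χ hu] at h
    exact inv_ne_zero hp0 h

/-- If the level `N` is `f · (p · q)` with `f ≠ 0`, `p` prime and `p · q ≠ 0`, then
`M := f · q` satisfies `0 < M < N`. [folklore] -/
theorem level_lt {f p q N : ℕ} (hf : f ≠ 0) (hp : p.Prime) (hpq : p * q ≠ 0)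
    (hN : N = f * (p * q)) : f * q < N := by
  subst hN
  have hq : 0 < q := Nat.pos_of_ne_zero (right_ne_zero_of_mul hpq)
  have hfq : 0 < f * q := Nat.mul_pos (Nat.pos_of_ne_zero hf) hq
  calc f * q < p * (f * q) := lt_mul_of_one_lt_left hfq hp.one_lt
    _ = f * (p * q) := by ring

/-! ### The level-raising step, transported along `N = M · p` -/

/-- (H2) transported along an equation of levels `N = M · p` and a factorisation `χ = χ'↑`:
`Λ_N(χ) = (1/p − χ'(p)) · Λ_M(χ')`. [folklore] -/
theorem level_eq
    (H2 : ∀ (M p : ℕ) [NeZero M] [NeZero (M * p)], p.Prime → ∀ χ : DirichletCharacter ℂ M,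
      (∑ c : ZMod (M * p), DirichletCharacter.changeLevel (dvd_mul_right M p) χ c *
          (blochWignerDilog (Complex.exp (2 * Real.pi * Complex.I / (M * p : ℕ)) ^ c.val) : ℂ)) =
        ((p : ℂ)⁻¹ - χ (p : ZMod M)) *
          ∑ c : ZMod M, χ c *
            (blochWignerDilog (Complex.exp (2 * Real.pi * Complex.I / M) ^ c.val) : ℂ))
    (M p : ℕ) [NeZero M] (hp : p.Prime) (N : ℕ) [NeZero N] (hN : N = M * p) (hMN : M ∣ N)
    (χ' : DirichletCharacter ℂ M) (χ : DirichletCharacter ℂ N)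
    (hχ : χ = DirichletCharacter.changeLevel hMN χ') :
    (∑ c : ZMod N, χ c *
        (blochWignerDilog (Complex.exp (2 * Real.pi * Complex.I / N) ^ c.val) : ℂ)) =
      ((p : ℂ)⁻¹ - χ' (p : ZMod M)) *
        ∑ c : ZMod M, χ' c *
          (blochWignerDilog (Complex.exp (2 * Real.pi * Complex.I / M) ^ c.val) : ℂ) := by
  subst hN
  subst hχ
  exact H2 M p hp χ'

end ClausenInduction

open ClausenInduction in
/-- **Non-vanishing of the Clausen character sum of every odd character.** Given (H1) the
primitive case and (H2) level raising `Λ_{Mp}(χ↑) = (1/p − χ(p)) Λ_M(χ)`: for every `N ≥ 1` and every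
odd Dirichlet character `χ mod N`, `Σ_{c mod N} χ(c) D(ζ_N^c) ≠ 0` — by strong induction over the level
along `cond(χ) ∣ N/p ∣ N`, each step a non-zero factor `1/p − χ'(p)` (`|χ'(p)| ∈ {0, 1}`).
[cite: Apostol1976, §8.9] -/
theorem stub_clausenCharSum_ne_zero :
    (∀ (N : ℕ) [NeZero N] (χ : DirichletCharacter ℂ N), χ.IsPrimitive → χ.Odd →
      (∑ c : ZMod N, χ c *
          (blochWignerDilog (Complex.exp (2 * Real.pi * Complex.I / N) ^ c.val) : ℂ)) ≠ 0) →
    (∀ (M p : ℕ) [NeZero M] [NeZero (M * p)], p.Prime → ∀ χ : DirichletCharacter ℂ M,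
      (∑ c : ZMod (M * p), DirichletCharacter.changeLevel (dvd_mul_right M p) χ c *
          (blochWignerDilog (Complex.exp (2 * Real.pi * Complex.I / (M * p : ℕ)) ^ c.val) : ℂ)) =
        ((p : ℂ)⁻¹ - χ (p : ZMod M)) *
          ∑ c : ZMod M, χ c *
            (blochWignerDilog (Complex.exp (2 * Real.pi * Complex.I / M) ^ c.val) : ℂ)) →
    ∀ (N : ℕ) [NeZero N] (χ : DirichletCharacter ℂ N), χ.Odd →
      (∑ c : ZMod N, χ c *
          (blochWignerDilog (Complex.exp (2 * Real.pi * Complex.I / N) ^ c.val) : ℂ)) ≠ 0 := by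
  intro H1 H2 N
  induction N using Nat.strong_induction_on with
  | _ N ih =>
  intro _ χ hodd
  by_cases hprim : χ.IsPrimitive
  · exact H1 N χ hprim hodd
  -- the conductor `f` is a proper divisor of `N = f · k`
  obtain ⟨k, hk⟩ := χ.conductor_dvd_level
  have hf0 : χ.conductor ≠ 0 := χ.conductor_ne_zero
  have hk1 : k ≠ 1 := by
    rintro rfl
    exact hprim (hk.trans (mul_one _)).symm
  have hk0 : k ≠ 0 := by
    rintro rfl
    exact NeZero.ne N (hk.trans (mul_zero _))
  -- a prime `p ∣ k`, `k = p · q`, `M := f · q`, `N = M · p`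
  obtain ⟨p, hp, q, rfl⟩ := Nat.exists_prime_and_dvd hk1
  have hM0 : χ.conductor * q ≠ 0 := mul_ne_zero hf0 (right_ne_zero_of_mul hk0)
  haveI : NeZero (χ.conductor * q) := ⟨hM0⟩
  have hN : N = χ.conductor * q * p := hk.trans (by ring)
  have hMN : χ.conductor * q ∣ N := ⟨p, hN⟩
  -- `χ` factors through `M`: `χ = χ'↑`, `χ'` odd
  obtain ⟨hMN', χ', hχ'⟩ :=
    DirichletCharacter.FactorsThrough.mono χ χ.factorsThrough_conductor (dvd_mul_right _ q) hMN
  have hodd' : χ'.Odd := odd_of_odd_changeLevel hMN' χ' (hχ' ▸ hodd)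
  -- induction hypothesis at level `M < N`
  have hlt : χ.conductor * q < N := level_lt hf0 hp hk0 hk
  have ihM := ih (χ.conductor * q) hlt χ' hodd'
  exact ne_of_eq_of_ne (level_eq H2 (χ.conductor * q) p hp N hN hMN' χ' χ hχ')
    (mul_ne_zero (inv_sub_char_ne_zero hp χ') ihM)

end Summit.KontsevichZagierPeriods.HyperbolicBloch.ZagierDilogarithmCyclotomic

end
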